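import Summits.Ventures.CertifiedManyBodySolver.Downfold.BoxesNdNiO2MLadder
import Summits.Ventures.CertifiedManyBodySolver.Downfold.BoxesS2Cell1
import Summits.Ventures.CertifiedManyBodySolver.Downfold.BoxesNdNiO2FillingLadder
import HarnessLib

/-!
# The typed OBJECT-M box of record `boxNdNiO2M_M21` (NdNiO₂ parent film, box #20 column M21, P = 0), its kinematic energy-word shape,
# and the planning-rule arithmetic for the rung leaf «MOS2-ndnio2-M21»

Venture CertifiedManyBodySolver, cell `pub/hubbard-downfold` (MO-S1; D-0154 (1)(C) COVERAGE, material (iii) NdNiO₂), seat hubbard-cov-ndnio2-unc-1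
(`prover-hubbard-cov-ndnio2-unc-1-0`), lane «object M» (lead RULING R-ma, 2026-08-28T05:18Z); namespace `Summit.Ventures.CertifiedManyBodySolver.Downfold`.
Companion of `Downfold/BoxesNdNiO2MLadder.lean` (members → hulls → ROWS; every row entry used below is defined there with its provenance) and of
`Downfold/BoxesNdNiO2E.lean` (the object-E boxes; the filling entry `ndNiO2E_M21_n = [0.852, 0.954]` is SHARED). SOURCE: `router/BOXES/NdNiO2.md`
(sha16 `a02e41a7b870a485`) §OF-RECORD v1–v1.7 (object-M rows: `U/t [5.82, 9.8]`, `tp/t [−0.321, −0.160]`, `t_eV [0.32, 0.433]`, `tpp/t [0.066, 0.167]`,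
`tperp/t [0.041, 0.088]`, `V/t [0.49, 0.67]`, `W_eV [2.81, 3.40]`, `dsd [0.047, 0.147]`, `n` M21 `[0.852, 0.954]`; word of record «1BH+3BE»).

* §1 `boxNdNiO2M_M21`, `boxNdNiO2_M21_filling_shared`, corners, `boxNdNiO2M_M21_mem_iff` (the downward reading).
* §2 `boxNdNiO2M_M21_energyWord_kinematic` — THE TARGET SHAPE FOR THE M OBJECT (pattern `boxLa214M_M15_energyWord_kinematic`): an S2 window `[L, R]`
  for the `t–t′` energy density on the M box's own delivered cell gives `[L − (16/π²)·0.167, R + (16/π²)·0.167]` for the fixed-filling density of the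
  `t–t′–t″` object on the box; `(16/π²)·0.167 ≤ 0.271` (`ndNiO2M_M21_allowance_le`).
* §3 numbers-only planning arithmetic (START-HERE §7 (iv)) for the object-E rung leaf «MOS2-ndnio2-M21» typed by hubbard-cov-ndnio2-box-1
  (`Observables/RungLeavesCoverageNdNiO2.lean`): bar `4779578/10⁷ = floor₇(0.98·κ₂₁)`, `κ₂₁ = 4877121/10⁷` (`boxNdNiO2E_M21_stiffness_kinematic`);
  required certified margin below the kernel constant `2.0 %`, below the engine kinematic `0.4809983` [float] `0.63 %`, at `(U, t′, n) = (5, −23/50, 477/500)`.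
* §4 (append) `boxS2Cell1NdNiO2M` = the M box restricted to hubbard-fast's S2 cell #1 (the lead's CONTAINMENT reading of record, typed as `Refines`) +
  its `t–t′` energy-word door + `r₁` on the child columns (`W₁ ≤ 3.210` ⇒ `r₁ ≥ 0.769 ≥ 3/5`).
* §5 (append) the CHILD-column object-M boxes `boxNdNiO2M_M59 / _M22 / _M60` (family rows + per-column `n` (mod-1) / `dsd` (unc-3) / M60's own `tperp/t`);
  cell #1 ⊂ M59's box too (`boxS2Cell1_refines_NdNiO2M_M59`) and is filling-DISJOINT from the superconducting x = 0.20 column and from x = 0.25.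

Everything is PROVED (definitions with bodies; no `sorry`). HONEST FRAMING: S1's SYSTEMATIC (screening-grade) box typed verbatim — typing certifies nothing
about NdNiO₂; the energy word inherits the hypotheses of whatever S2 statement is plugged into `hE`; energy words only (object M carries no stiffness leaf
today: its `tp/t` row `[−0.321, −0.160]` is not inside a kernel leaf's `t′` range); no leaf, bar of record or phase sentence is asserted here; no summit
statement is proved by this file.
-/

noncomputable section

namespace Summit.Ventures.CertifiedManyBodySolver.Downfold

open NonemptyInterval Literature.MathematicalPhysics.QuantumLattice
  Literature.MathematicalPhysics.QuantumLattice.ThermodynamicLimit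

/-! ## §1 The typed object-M box `boxNdNiO2M_M21` (column M21, P = 0) -/

/-- **`W_eV` ROW OF RECORD** `[2.81, 3.40]` eV (W₁ fitted 3.078 / 3.128; DERIVED `8t ∈ [2.95, 3.16]`; LIT «about 3 eV» Nomura 2019 p. 6; FLOOR + INFL-T). [folklore] -/
def ndNiO2M_W : Entry := Entry.ofEnds (281/100) (17/5) (by norm_num) .screening

/-- **`dsd` ROW OF RECORD** `[0.047, 0.147]` e/Ni (three objects kept apart; unc-3's filling ladder carries the members). [folklore] -/
def ndNiO2M_dsd : Entry := Entry.ofEnds (47/1000) (147/1000) (by norm_num) .screening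

/-- **The typed OBJECT-M box of record `boxNdNiO2M_M21`** (NdNiO₂ parent film, VSET #21, column M21, P = 0): `U/t ∈ [5.82, 9.8]`, `tp/t ∈ [−0.321, −0.160]`,
`n ∈ [0.852, 0.954]` (the entry `ndNiO2E_M21_n`, SHARED with object E), `t ∈ [0.32, 0.433]` eV, `tpp/t ∈ [0.066, 0.167]`, `tperp/t ∈ [0.041, 0.088]`,
`V/t ∈ [0.49, 0.67]`, `W ∈ [2.81, 3.40]` eV, `dsd ∈ [0.047, 0.147]`; `J` is DERIVED context (no entry). Inside hubbard-fast's 𝒟 in `tp/t` (unlike object E). [folklore] -/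
def boxNdNiO2M_M21 : OneBandBox := fun c =>
  match c with
  | .UOverT => some ndNiO2M_UoverT
  | .tpOverT => some ndNiO2M_tp
  | .filling => some ndNiO2E_M21_n
  | .tEV => some ndNiO2M_t
  | .tppOverT => some ndNiO2M_tpp
  | .tperpOverT => some ndNiO2M_tperp
  | .VOverT => some ndNiO2M_VoverT
  | .WEV => some ndNiO2M_W
  | .dsd => some ndNiO2M_dsd
  | .JmeV => none

/-- **The E and M boxes of column M21 share the filling entry** (two readings of one band; BOX-SCHEMA §1 / C9: never mixed in one product box). [folklore] -/
theorem boxNdNiO2_M21_filling_shared : boxNdNiO2E_M21 .filling = boxNdNiO2M_M21 .filling := rfl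

/-- Corners of the delivered S2 box of `boxNdNiO2M_M21`: `(5.82, −0.321, 0.852)` and `(9.8, −0.160, 0.954)`. [folklore] -/
theorem ndNiO2M_M21_s2Lo_s2Hi :
    s2Lo ndNiO2M_UoverT ndNiO2M_tp ndNiO2E_M21_n = ![291/50, -321/1000, 213/250] ∧
      s2Hi ndNiO2M_UoverT ndNiO2M_tp ndNiO2E_M21_n = ![49/5, -4/25, 477/500] := by
  constructor <;> (ext i; fin_cases i <;> simp [s2Lo, s2Hi, ndNiO2M_UoverT, ndNiO2M_tp, ndNiO2E_M21_n])

/-- **Membership in `boxNdNiO2M_M21` unfolded** (the downward reading; order `U/t, tp/t, n, t, tpp/t, tperp/t, V/t, W, dsd`). [folklore] -/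
theorem boxNdNiO2M_M21_mem_iff (p : OneBandCoord → ℝ) :
    boxNdNiO2M_M21.Mem p ↔
      ((291/50 : ℚ) : ℝ) ≤ p .UOverT ∧ p .UOverT ≤ ((49/5 : ℚ) : ℝ) ∧ ((-321/1000 : ℚ) : ℝ) ≤ p .tpOverT ∧ p .tpOverT ≤ ((-4/25 : ℚ) : ℝ) ∧
      ((213/250 : ℚ) : ℝ) ≤ p .filling ∧ p .filling ≤ ((477/500 : ℚ) : ℝ) ∧ ((8/25 : ℚ) : ℝ) ≤ p .tEV ∧ p .tEV ≤ ((433/1000 : ℚ) : ℝ) ∧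
      ((33/500 : ℚ) : ℝ) ≤ p .tppOverT ∧ p .tppOverT ≤ ((167/1000 : ℚ) : ℝ) ∧ ((41/1000 : ℚ) : ℝ) ≤ p .tperpOverT ∧ p .tperpOverT ≤ ((11/125 : ℚ) : ℝ) ∧
      ((49/100 : ℚ) : ℝ) ≤ p .VOverT ∧ p .VOverT ≤ ((67/100 : ℚ) : ℝ) ∧ ((281/100 : ℚ) : ℝ) ≤ p .WEV ∧ p .WEV ≤ ((17/5 : ℚ) : ℝ) ∧
      ((47/1000 : ℚ) : ℝ) ≤ p .dsd ∧ p .dsd ≤ ((147/1000 : ℚ) : ℝ) := by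
  constructor
  · intro h
    have h0 := (Entry.mem_ofEnds_iff _ _ _ _ _).1 (h .UOverT ndNiO2M_UoverT rfl)
    have h1 := (Entry.mem_ofEnds_iff _ _ _ _ _).1 (h .tpOverT ndNiO2M_tp rfl)
    have h2 := (Entry.mem_ofEnds_iff _ _ _ _ _).1 (h .filling ndNiO2E_M21_n rfl)
    have h3 := (Entry.mem_ofEnds_iff _ _ _ _ _).1 (h .tEV ndNiO2M_t rfl)
    have h4 := (Entry.mem_ofEnds_iff _ _ _ _ _).1 (h .tppOverT ndNiO2M_tpp rfl)
    have h5 := (Entry.mem_ofEnds_iff _ _ _ _ _).1 (h .tperpOverT ndNiO2M_tperp rfl)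
    have h6 := (Entry.mem_ofEnds_iff _ _ _ _ _).1 (h .VOverT ndNiO2M_VoverT rfl)
    have h7 := (Entry.mem_ofEnds_iff _ _ _ _ _).1 (h .WEV ndNiO2M_W rfl)
    have h8 := (Entry.mem_ofEnds_iff _ _ _ _ _).1 (h .dsd ndNiO2M_dsd rfl)
    exact ⟨h0.1, h0.2, h1.1, h1.2, h2.1, h2.2, h3.1, h3.2, h4.1, h4.2, h5.1, h5.2, h6.1, h6.2, h7.1, h7.2, h8.1, h8.2⟩
  · rintro ⟨a0, b0, a1, b1, a2, b2, a3, b3, a4, b4, a5, b5, a6, b6, a7, b7, a8, b8⟩ i e hi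
    cases i <;> simp only [boxNdNiO2M_M21, Option.some.injEq, reduceCtorEq] at hi <;> subst hi
    · exact (Entry.mem_ofEnds_iff _ _ _ _ _).2 ⟨a0, b0⟩
    · exact (Entry.mem_ofEnds_iff _ _ _ _ _).2 ⟨a1, b1⟩
    · exact (Entry.mem_ofEnds_iff _ _ _ _ _).2 ⟨a2, b2⟩
    · exact (Entry.mem_ofEnds_iff _ _ _ _ _).2 ⟨a3, b3⟩
    · exact (Entry.mem_ofEnds_iff _ _ _ _ _).2 ⟨a4, b4⟩
    · exact (Entry.mem_ofEnds_iff _ _ _ _ _).2 ⟨a5, b5⟩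
    · exact (Entry.mem_ofEnds_iff _ _ _ _ _).2 ⟨a6, b6⟩
    · exact (Entry.mem_ofEnds_iff _ _ _ _ _).2 ⟨a7, b7⟩
    · exact (Entry.mem_ofEnds_iff _ _ _ _ _).2 ⟨a8, b8⟩

/-! ## §2 The kinematic energy-word shape on `boxNdNiO2M_M21` -/

/-- `max |t″/t|` over the row is `0.167`. [folklore] -/
theorem ndNiO2M_tpp_abs : (max |ndNiO2M_tpp.encl.fst| |ndNiO2M_tpp.encl.snd| : ℚ) = 167/1000 := by
  rw [ndNiO2M_tpp, Entry.encl_ofEnds_fst, Entry.encl_ofEnds_snd]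
  norm_num [abs_of_nonneg]

/-- **THE TARGET SHAPE FOR THE M OBJECT (kinematic constant)**: an S2 window `[L, R]` for the `t–t′` energy density on the M box's OWN delivered cell
`Set.Icc ![5.82, −0.321, 0.852] ![9.8, −0.160, 0.954]` gives `L − (16/π²)(0.167) ≤ e_n(1, tp/t, tpp/t, U/t) ≤ R + (16/π²)(0.167)` for the fixed-filling ground-energy
density of the `t–t′–t″` object at every point of `boxNdNiO2M_M21` (`TppSeamFilling`). [cite: LiebLoss1993, §8, Theorem 8.2] -/
theorem boxNdNiO2M_M21_energyWord_kinematic {L R : ℝ}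
    (hE : ∀ θ ∈ Set.Icc (![291/50, -321/1000, 213/250] : Fin 3 → ℝ) ![49/5, -4/25, 477/500],
      L ≤ energyDensityTT' 1 (θ 1) (θ 0) (θ 2) ∧ energyDensityTT' 1 (θ 1) (θ 0) (θ 2) ≤ R) :
    HoldsOn (fun p : OneBandCoord → ℝ =>
      L - 16 / Real.pi ^ 2 * (167/1000 : ℝ) ≤
          (hubbardTT'T''FermionInteraction 1 (p .tpOverT) (p .tppOverT) (p .UOverT)).tiGroundEnergyDensityAt 2 (p .filling) ∧
        (hubbardTT'T''FermionInteraction 1 (p .tpOverT) (p .tppOverT) (p .UOverT)).tiGroundEnergyDensityAt 2 (p .filling) ≤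
          R + 16 / Real.pi ^ 2 * (167/1000 : ℝ)) boxNdNiO2M_M21 := by
  have h := holdsOn_tiGroundEnergyDensityAt_objectM_kinematic (B := boxNdNiO2M_M21) (eU := ndNiO2M_UoverT)
    (eS := ndNiO2M_tp) (eSS := ndNiO2M_tpp) (eN := ndNiO2E_M21_n) rfl rfl rfl rfl
    (by rw [ndNiO2M_UoverT, Entry.encl_ofEnds_fst]; norm_num)
    (by rw [ndNiO2E_M21_n, Entry.encl_ofEnds_fst]; norm_num)
    (by rw [ndNiO2E_M21_n, Entry.encl_ofEnds_snd]; norm_num)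
    (L := L) (R := R) (by rw [ndNiO2M_M21_s2Lo_s2Hi.1, ndNiO2M_M21_s2Lo_s2Hi.2]; exact hE)
  rw [ndNiO2M_tpp_abs] at h
  have hc : (((167/1000 : ℚ)) : ℝ) = (167/1000 : ℝ) := by norm_num
  rw [hc] at h
  exact h

/-- **Decimal allowance**: `(16/π²)·0.167 ≤ 0.271` (units of `t`). [folklore] -/
theorem ndNiO2M_M21_allowance_le : 16 / Real.pi ^ 2 * (167/1000 : ℝ) ≤ 0.271 := by
  have h := kinematic_allowance_le (167/1000 : ℝ) (by norm_num)
  linarith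

/-! ## §3 Planning-rule arithmetic for the rung leaf «MOS2-ndnio2-M21» (START-HERE §7 (iv)); numbers only, no leaf is typed here -/

/-- **The bar is `floor₇(0.98·κ₂₁)`**: with `κ₂₁ = 4877121/10⁷` (`boxNdNiO2E_M21_stiffness_kinematic`, the kernel constant = the four-corner majorant at the box corner
`(t′, n) = (−23/50, 477/500)`), `4779578/10⁷ ≤ 0.98·κ₂₁ < 4779579/10⁷`. [folklore] -/
theorem ndNiO2M21_bar_is_floor : (4779578 / 10 ^ 7 : ℚ) ≤ 98 / 100 * (4877121 / 10 ^ 7) ∧ (98 / 100 : ℚ) * (4877121 / 10 ^ 7) < 4779579 / 10 ^ 7 := by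
  constructor <;> norm_num

/-- **What a certified solve must deliver at the binding corner `(U, t′, n) = (5, −23/50, 477/500)` before any transport price**: at least `2.0 %` below the
kernel constant `0.4877121`, i.e. at least `0.63 %` below the cell's engine kinematic value `0.4809983` [float, engine preview at that corner]. [folklore] -/
theorem ndNiO2M21_required_margins :
    (2 / 100 : ℚ) ≤ (4877121 - 4779578) / 4877121 ∧ (63 / 10000 : ℚ) ≤ (4809983 - 4779578) / 4809983 ∧
      (4809983 - 4779578 : ℚ) / 4809983 < 64 / 10000 := by
  refine ⟨?_, ?_, ?_⟩ <;> norm_num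

/-! ## §4 (append, same seat, 2026-08-28) hubbard-fast's S2 CELL #1 inside the object-M box — the lead's CONTAINMENT reading of record, typed — and `r₁` on the child columns

§OF-RECORD v1 (2026-08-26T19:10Z) «CONTAINMENT vs hubbard-fast S2 box #1 (U/t 8 ± 0.5, tp/t −0.25 ± 0.05, n 0.875 ± 0.01), object M: U/t ✓ · tp/t ✓ · n ✓ ⊂ M21's
[0.852, 0.954] ⇒ box #1 ⊂ NdNiO₂ PARENT (M21) — full containment» (v1.1: «holds for OBJECT M ONLY»; object E is DISJOINT in tp/t). HONEST FRAMING, with the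
lead's R-me (d) clause: M21's truth of record is «known-nonSC» for the PLD/CaH₂-capped parent-film class (weakly insulating, no SC to 0.05 K); MBE/atomic-H-capped
films show partial onsets 5–11 K without R = 0 (Parzyck et al. PRX 15 021048 (2025)) — a booked truth contest, not a word input; containment is bookkeeping of a
SYSTEMATIC box against a certified cell and says nothing about superconductivity in NdNiO₂. -/

/-- **`boxS2Cell1NdNiO2M`** — the NdNiO₂ parent OBJECT-M box RESTRICTED to hubbard-fast's cuprate cell #1 `(U/t, t′/t, n) ∈ [15/2, 17/2] × [−3/10, −1/5] ×
[173/200, 177/200]` (the entries `s2Cell1La214E_U / _tp / _n` of `BoxesS2Cell1.lean`, re-used by name — the S2 cell is material-agnostic): three INWARD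
`Box.withEntry` re-issues of `boxNdNiO2M_M21`; every other row (`t`, `t″/t`, `t⊥/t`, `V/t`, `W`, `dsd`) is M21's. A SUB-box for reading S2's cell-#1 words on the
nickelate parent, not a box of record. [folklore] -/
def boxS2Cell1NdNiO2M : OneBandBox :=
  ((boxNdNiO2M_M21.withEntry .UOverT s2Cell1La214E_U).withEntry .tpOverT s2Cell1La214E_tp).withEntry .filling s2Cell1La214E_n

/-- Accessor: the filling entry of `boxS2Cell1NdNiO2M` is cell #1's `[173/200, 177/200]`. [folklore] -/
theorem boxS2Cell1NdNiO2M_n : boxS2Cell1NdNiO2M .filling = some s2Cell1La214E_n := Box.withEntry_self _ _ _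
/-- Accessor: the `tp/t` entry of `boxS2Cell1NdNiO2M` is cell #1's `[−3/10, −1/5]`. [folklore] -/
theorem boxS2Cell1NdNiO2M_tp : boxS2Cell1NdNiO2M .tpOverT = some s2Cell1La214E_tp := by
  rw [boxS2Cell1NdNiO2M, Box.withEntry_of_ne _ _ (by decide), Box.withEntry_self]
/-- Accessor: the `U/t` entry of `boxS2Cell1NdNiO2M` is cell #1's `[15/2, 17/2]`. [folklore] -/
theorem boxS2Cell1NdNiO2M_U : boxS2Cell1NdNiO2M .UOverT = some s2Cell1La214E_U := by
  rw [boxS2Cell1NdNiO2M, Box.withEntry_of_ne _ _ (by decide), Box.withEntry_of_ne _ _ (by decide), Box.withEntry_self]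
/-- Accessor: the `t` entry of `boxS2Cell1NdNiO2M` is M21's `[0.32, 0.433]` eV (the nickelate's own scale travels with the cell). [folklore] -/
theorem boxS2Cell1NdNiO2M_t : boxS2Cell1NdNiO2M .tEV = some ndNiO2M_t := by
  rw [boxS2Cell1NdNiO2M, Box.withEntry_of_ne _ _ (by decide), Box.withEntry_of_ne _ _ (by decide), Box.withEntry_of_ne _ _ (by decide)]; rfl

/-- **THE CONTAINMENT READING, typed: `boxS2Cell1NdNiO2M ⊆ boxNdNiO2M_M21`** — cell #1's three faces sit inside M21's object-M rows: `U/t [15/2, 17/2] ⊂ [5.82, 9.8]`,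
`tp/t [−3/10, −1/5] ⊂ [−0.321, −0.160]`, `n [173/200, 177/200] ⊂ [0.852, 0.954]` (three INWARD re-issues ⇒ `Refines`). [folklore] -/
theorem boxS2Cell1NdNiO2M_refines_M21 : boxS2Cell1NdNiO2M.Refines boxNdNiO2M_M21 := by
  have h1 : (boxNdNiO2M_M21.withEntry .UOverT s2Cell1La214E_U).Refines boxNdNiO2M_M21 :=
    Box.withEntry_refines (e₀ := ndNiO2M_UoverT) rfl (fun _ hx => Entry.mem_ofEnds_mono (by norm_num) (by norm_num) hx)
  have h2 : ((boxNdNiO2M_M21.withEntry .UOverT s2Cell1La214E_U).withEntry .tpOverT s2Cell1La214E_tp).Refines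
      (boxNdNiO2M_M21.withEntry .UOverT s2Cell1La214E_U) :=
    Box.withEntry_refines (e₀ := ndNiO2M_tp) (by rw [Box.withEntry_of_ne _ _ (by decide)]; rfl)
      (fun _ hx => Entry.mem_ofEnds_mono (by norm_num) (by norm_num) hx)
  have h3 : boxS2Cell1NdNiO2M.Refines
      ((boxNdNiO2M_M21.withEntry .UOverT s2Cell1La214E_U).withEntry .tpOverT s2Cell1La214E_tp) :=
    Box.withEntry_refines (e₀ := ndNiO2E_M21_n)
      (by rw [Box.withEntry_of_ne _ _ (by decide), Box.withEntry_of_ne _ _ (by decide)]; rfl)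
      (fun _ hx => Entry.mem_ofEnds_mono (by norm_num) (by norm_num) hx)
  exact h3.trans (h2.trans h1)

/-- **Every word on the object-M box of record holds on the cell-#1 sub-box** (e.g. `boxNdNiO2M_M21_energyWord_kinematic`'s conclusion). [folklore] -/
theorem holdsOn_boxS2Cell1NdNiO2M_of_M21 {W : (OneBandCoord → ℝ) → Prop} (h : HoldsOn W boxNdNiO2M_M21) :
    HoldsOn W boxS2Cell1NdNiO2M :=
  h.of_refines boxS2Cell1NdNiO2M_refines_M21

/-- Corners of the delivered box of `boxS2Cell1NdNiO2M` = cell #1 exactly. [folklore] -/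
theorem s2Cell1NdNiO2M_s2Lo_s2Hi :
    s2Lo s2Cell1La214E_U s2Cell1La214E_tp s2Cell1La214E_n = ![15/2, -3/10, 173/200] ∧
      s2Hi s2Cell1La214E_U s2Cell1La214E_tp s2Cell1La214E_n = ![17/2, -1/5, 177/200] :=
  ⟨s2Cell1La214E_s2Lo, s2Cell1La214E_s2Hi⟩

/-- **What S2's cell-#1 certificates say about the nickelate parent (object M)**: ANY S2 statement of the `_word_Icc` shape on cell #1
`Set.Icc ![15/2, −3/10, 173/200] ![17/2, −1/5, 177/200]` is the `t–t′` energy word on `boxS2Cell1NdNiO2M` — i.e. on the part of the NdNiO₂ M21 object-M box that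
cell #1 covers (the reading «S2's first certified box may speak to undoped NdNiO₂», §LIT-PREVIEW v1 / §OF-RECORD v1). The `t″/t ≠ 0` of object M is NOT in this
`t–t′` word; the `t–t′–t″` object needs the kinematic allowance of `boxNdNiO2M_M21_energyWord_kinematic` (transferable here by `holdsOn_boxS2Cell1NdNiO2M_of_M21`).
[folklore] -/
theorem boxS2Cell1NdNiO2M_energyWord {lo hi : ℝ}
    (hW : ∀ θ ∈ Set.Icc (![15/2, -3/10, 173/200] : Fin 3 → ℝ) ![17/2, -1/5, 177/200],
      lo ≤ energyDensityTT' 1 (θ 1) (θ 0) (θ 2) ∧ energyDensityTT' 1 (θ 1) (θ 0) (θ 2) ≤ hi) :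
    HoldsOn (fun p : OneBandCoord → ℝ =>
      lo ≤ energyDensityTT' 1 (p .tpOverT) (p .UOverT) (p .filling) ∧
        energyDensityTT' 1 (p .tpOverT) (p .UOverT) (p .filling) ≤ hi) boxS2Cell1NdNiO2M := by
  have h := holdsOn_of_forall_s2Box (B := boxS2Cell1NdNiO2M) (eU := s2Cell1La214E_U) (eS := s2Cell1La214E_tp)
    (eN := s2Cell1La214E_n) boxS2Cell1NdNiO2M_U boxS2Cell1NdNiO2M_tp boxS2Cell1NdNiO2M_n
    (W := fun θ => lo ≤ energyDensityTT' 1 (θ 1) (θ 0) (θ 2) ∧ energyDensityTT' 1 (θ 1) (θ 0) (θ 2) ≤ hi)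
    (by rw [s2Cell1La214E_s2Lo, s2Cell1La214E_s2Hi]; exact hW)
  exact h

/-- **`r₁` on the CHILD columns** (M22 / M59 / M60: `W₁` hull widens to `[3.078, 3.210]` with sr20 3.184, sr25 3.210; §R-ac FOLD v1 rows `r₁` M22 `[0.775, 1.04]`,
M60 `[0.769, 1.04]`): `U ∈ [2.47, 3.2]`, `W₁ ∈ [3.078, 3.210]` ⇒ `0.769 ≤ r₁ ≤ 1.04` and `r₁ ≥ 3/5` — «1BH» decided on every column (margin `0.169`). [folklore] -/
theorem ndNiO2M_r1_family_of_mem {U W : ℝ} (hU : ndNiO2M_Uabs.Mem U) (hW : (3078/1000 : ℝ) ≤ W ∧ W ≤ 3210/1000) :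
    (769/1000 : ℝ) ≤ U / W ∧ U / W ≤ 26/25 ∧ (3 / 5 : ℝ) ≤ U / W := by
  have hU' := (Entry.mem_ofEnds_iff _ _ _ _ _).1 hU
  push_cast at hU'
  obtain ⟨h1, h2⟩ := divPos_bounds (by norm_num) (by norm_num) hU' hW
  exact ⟨le_trans (by norm_num) h1, le_trans h2 (by norm_num), le_trans (by norm_num) h1⟩


/-! ## §5 (append, same seat, 2026-08-28) The object-M boxes of the CHILD columns M59 (x = 0.10), M22 (x = 0.20 — the SUPERCONDUCTING film composition, truth «known-SC»
T_c 10 ± 4 K [float]), M60 (x = 0.25), and WHERE hubbard-fast's S2 cell #1 sits among them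

§OF-RECORD v1 / §R-ac FOLD v1: the hopping rows are FAMILY rows («hoppings for M22: parent intervals reused — INFL-dop: d(tp/t) +0.014, d(tpp/t) 0.000 inside FLOOR;
dt/t +3.8 % inside FLOOR(t)»; «U/t (M) OF RECORD (M21 and family row for M22/M59/M60) [5.82, 9.8]»); per column only the filling entry (mod-1's `ndSrNiO2E_M{59,22,60}_n`,
re-used by name), the `dsd` row (unc-3's `ndNiO2Fill_dsdRow_x010 / _x025`, re-used by name; M22's film column has no `dsd` row of record — its band-count
deficit `dsd(0.2) = 0.032` is a value in unc-3's §2, so the entry is left UNDETERMINED) and, for M60 ONLY, the `tperp/t` row (`[0.041, 0.098]`, NdNiO2.md l.177: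
the charged-cell sr25 leg `t_z/t = 0.097` leaves the family hull — «DISAGREEMENT LOGGED … then hull») differ. HONEST FRAMING as §4 (truths: M59 / M60 «known-nonSC»
to 0.05 K, M22 «known-SC», Li 2020 [float]; object-M containment is bookkeeping, not a phase statement). -/

/-- **`tperp/t` ROW of the x = 0.25 column ONLY** `[0.041, 0.098]` (NdNiO2.md l.177: family row `[0.041, 0.088]` ∪ WAN:j264356/sr25 uniform `t_z = 0.0377` eV ⇒ `t_z/t = 0.097`;
fitted ⇒ no ×/÷2 floor). [folklore] -/
def ndNiO2M_tperp_M60col : Entry := Entry.ofEnds (41/1000) (49/500) (by norm_num) .screening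

/-- The sr25 member `0.097` lies in the M60 column row and NOT in the family row `[0.041, 0.088]` (the logged disagreement, kernel side). [folklore] -/
theorem ndNiO2M_tperp_sr25_mem_M60col_not_family :
    ndNiO2M_tperp_M60col.Mem ((97/1000 : ℚ) : ℝ) ∧ ¬ ndNiO2M_tperp.Mem ((97/1000 : ℚ) : ℝ) := by
  refine ⟨Entry.mem_ofEnds_of_rat (by norm_num) (by norm_num), fun h => ?_⟩
  have h' := ((Entry.mem_ofEnds_iff _ _ _ _ _).1 h).2
  exact absurd h' (by norm_num)

/-- **`boxNdNiO2M_M59`** — Nd₀.₉Sr₀.₁NiO₂ (x = 0.10, VSET-v2 M59), object M: family rows + `n = ndSrNiO2E_M59_n` `[0.79, 0.89]` + `dsd = ndNiO2Fill_dsdRow_x010` `[0, 0.096]`. [folklore] -/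
def boxNdNiO2M_M59 : OneBandBox := (boxNdNiO2M_M21.withEntry .filling ndSrNiO2E_M59_n).withEntry .dsd ndNiO2Fill_dsdRow_x010

/-- **`boxNdNiO2M_M22`** — Nd₀.₈Sr₀.₂NiO₂ (x = 0.20, VSET #22, the superconducting film composition), object M: family rows + `n = ndSrNiO2E_M22_n` `[0.718, 0.818]`; `dsd`
UNDETERMINED (no row of record for the film column). [folklore] -/
def boxNdNiO2M_M22 : OneBandBox := Function.update (boxNdNiO2M_M21.withEntry .filling ndSrNiO2E_M22_n) .dsd none

/-- **`boxNdNiO2M_M60`** — Nd₀.₇₅Sr₀.₂₅NiO₂ (x = 0.25, VSET-v2 M60), object M: family rows + `n = ndSrNiO2E_M60_n` `[0.686, 0.786]` + `dsd = ndNiO2Fill_dsdRow_x025` `[0, 0.062]` +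
the column's own `tperp/t` row `[0.041, 0.098]`. [folklore] -/
def boxNdNiO2M_M60 : OneBandBox :=
  ((boxNdNiO2M_M21.withEntry .filling ndSrNiO2E_M60_n).withEntry .dsd ndNiO2Fill_dsdRow_x025).withEntry .tperpOverT ndNiO2M_tperp_M60col

/-- **Each child M box shares its filling entry with mod-1's E box of the same column** (one `n` decl per column across objects). [folklore] -/
theorem boxNdNiO2M_children_filling_shared :
    boxNdNiO2M_M59 .filling = boxNdSrNiO2E_M59 .filling ∧ boxNdNiO2M_M22 .filling = boxNdSrNiO2E_M22 .filling ∧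
      boxNdNiO2M_M60 .filling = boxNdSrNiO2E_M60 .filling := by
  refine ⟨?_, ?_, ?_⟩
  · rw [boxNdNiO2M_M59, Box.withEntry_of_ne _ _ (by decide), Box.withEntry_self]; rfl
  · rw [boxNdNiO2M_M22, Function.update_of_ne (by decide), Box.withEntry_self]; rfl
  · rw [boxNdNiO2M_M60, Box.withEntry_of_ne _ _ (by decide), Box.withEntry_of_ne _ _ (by decide), Box.withEntry_self]; rfl

/-- **Each child M box carries the FAMILY `U/t` and `tp/t` rows** (`[5.82, 9.8]`, `[−0.321, −0.160]`). [folklore] -/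
theorem boxNdNiO2M_children_family_rows :
    (boxNdNiO2M_M59 .UOverT = some ndNiO2M_UoverT ∧ boxNdNiO2M_M59 .tpOverT = some ndNiO2M_tp) ∧
      (boxNdNiO2M_M22 .UOverT = some ndNiO2M_UoverT ∧ boxNdNiO2M_M22 .tpOverT = some ndNiO2M_tp) ∧
      (boxNdNiO2M_M60 .UOverT = some ndNiO2M_UoverT ∧ boxNdNiO2M_M60 .tpOverT = some ndNiO2M_tp) := by
  refine ⟨⟨?_, ?_⟩, ⟨?_, ?_⟩, ⟨?_, ?_⟩⟩
  · rw [boxNdNiO2M_M59, Box.withEntry_of_ne _ _ (by decide), Box.withEntry_of_ne _ _ (by decide)]; rfl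
  · rw [boxNdNiO2M_M59, Box.withEntry_of_ne _ _ (by decide), Box.withEntry_of_ne _ _ (by decide)]; rfl
  · rw [boxNdNiO2M_M22, Function.update_of_ne (by decide), Box.withEntry_of_ne _ _ (by decide)]; rfl
  · rw [boxNdNiO2M_M22, Function.update_of_ne (by decide), Box.withEntry_of_ne _ _ (by decide)]; rfl
  · rw [boxNdNiO2M_M60, Box.withEntry_of_ne _ _ (by decide), Box.withEntry_of_ne _ _ (by decide), Box.withEntry_of_ne _ _ (by decide)]; rfl
  · rw [boxNdNiO2M_M60, Box.withEntry_of_ne _ _ (by decide), Box.withEntry_of_ne _ _ (by decide), Box.withEntry_of_ne _ _ (by decide)]; rfl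

/-- **hubbard-fast's S2 cell #1 ALSO sits inside the x = 0.10 column's object-M box** (`n` face `[173/200, 177/200] ⊂ [0.79, 0.89]`; `U/t`, `tp/t` family rows as for M21;
`dsd` of the sub-box = M21's `[0.047, 0.147]` is NOT inside M59's `[0, 0.096]`, so the containment is stated for the cell-#1 sub-box of M59 itself): the three INWARD
re-issues of `boxNdNiO2M_M59` to cell #1 REFINE `boxNdNiO2M_M59`. Truth of M59: «known-nonSC» to 0.05 K (Li 2020 [float]). [folklore] -/
theorem boxS2Cell1_refines_NdNiO2M_M59 :
    (((boxNdNiO2M_M59.withEntry .UOverT s2Cell1La214E_U).withEntry .tpOverT s2Cell1La214E_tp).withEntry .filling s2Cell1La214E_n).Refines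
      boxNdNiO2M_M59 := by
  obtain ⟨⟨hU, htp⟩, -, -⟩ := boxNdNiO2M_children_family_rows
  have hn : boxNdNiO2M_M59 .filling = some ndSrNiO2E_M59_n := by
    rw [boxNdNiO2M_M59, Box.withEntry_of_ne _ _ (by decide), Box.withEntry_self]
  have h1 : (boxNdNiO2M_M59.withEntry .UOverT s2Cell1La214E_U).Refines boxNdNiO2M_M59 :=
    Box.withEntry_refines (e₀ := ndNiO2M_UoverT) hU (fun _ hx => Entry.mem_ofEnds_mono (by norm_num) (by norm_num) hx)
  have h2 : ((boxNdNiO2M_M59.withEntry .UOverT s2Cell1La214E_U).withEntry .tpOverT s2Cell1La214E_tp).Refines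
      (boxNdNiO2M_M59.withEntry .UOverT s2Cell1La214E_U) :=
    Box.withEntry_refines (e₀ := ndNiO2M_tp) (by rw [Box.withEntry_of_ne _ _ (by decide)]; exact htp)
      (fun _ hx => Entry.mem_ofEnds_mono (by norm_num) (by norm_num) hx)
  have h3 : (((boxNdNiO2M_M59.withEntry .UOverT s2Cell1La214E_U).withEntry .tpOverT s2Cell1La214E_tp).withEntry .filling s2Cell1La214E_n).Refines
      ((boxNdNiO2M_M59.withEntry .UOverT s2Cell1La214E_U).withEntry .tpOverT s2Cell1La214E_tp) :=
    Box.withEntry_refines (e₀ := ndSrNiO2E_M59_n)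
      (by rw [Box.withEntry_of_ne _ _ (by decide), Box.withEntry_of_ne _ _ (by decide)]; exact hn)
      (fun _ hx => Entry.mem_ofEnds_mono (by norm_num) (by norm_num) hx)
  exact h3.trans (h2.trans h1)

/-- **… and is filling-DISJOINT from the SUPERCONDUCTING composition M22 and from M60**: no parameter vector of `boxNdNiO2M_M22` (n ≤ 0.818) or of `boxNdNiO2M_M60`
(n ≤ 0.786) has its filling in cell #1's `n` face `[0.865, 0.885]`. READING (object M, bookkeeping only): S2's cell-#1 words speak to the two «known-nonSC» columns M21 / M59 of
box #20 and NOT to the «known-SC» film composition x = 0.20 — by filling alone. [folklore] -/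
theorem boxNdNiO2M_M22_M60_filling_disjoint_cell1 (p : OneBandCoord → ℝ) :
    (boxNdNiO2M_M22.Mem p → ¬ s2Cell1La214E_n.Mem (p .filling)) ∧ (boxNdNiO2M_M60.Mem p → ¬ s2Cell1La214E_n.Mem (p .filling)) := by
  obtain ⟨-, h22, h60⟩ := boxNdNiO2M_children_filling_shared
  constructor
  · intro hp hc
    have hn := (Entry.mem_ofEnds_iff _ _ _ _ _).1 (hp .filling ndSrNiO2E_M22_n (by rw [h22]; rfl))
    have hc' := (Entry.mem_ofEnds_iff _ _ _ _ _).1 hc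
    push_cast at hn hc'
    linarith [hn.2, hc'.1]
  · intro hp hc
    have hn := (Entry.mem_ofEnds_iff _ _ _ _ _).1 (hp .filling ndSrNiO2E_M60_n (by rw [h60]; rfl))
    have hc' := (Entry.mem_ofEnds_iff _ _ _ _ _).1 hc
    push_cast at hn hc'
    linarith [hn.2, hc'.1]

/-- **`r₁` per child column stays above `θ_hi = 3/5`** at the column's own `W₁` top (M22: sr20 `3.184`; M60: sr25 `3.210`; §R-ac FOLD rows `[0.775, 1.04]` / `[0.769, 1.04]`):
the lowest admitted `U = 2.47` eV over the widest child band `3.210` eV gives `r₁ ≥ 0.769`. [folklore] -/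
theorem ndNiO2M_r1_children_lo : (3 / 5 : ℚ) + 169/1000 ≤ (247/100) / (3210/1000) ∧ (3 / 5 : ℚ) + 175/1000 ≤ (247/100) / (3184/1000) := by
  constructor <;> norm_num


end Summit.Ventures.CertifiedManyBodySolver.Downfold

end
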